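import Summits.KontsevichZagierPeriods.KontsevichZagierPeriods.Theorems.BetaCancellation.Negative.LoadBearing
import Summits.KontsevichZagierPeriods.KontsevichZagierPeriods.Theorems.MultiplicationThree.Negative.Pinned
import Literature.NumberTheory.Transcendental.KZRelationsLE

/-!
# `MultiplicationAccessible` (stmt-KontsevichZagierPeriods-12305), line `shifted-family-prime-sieve`,
stub `stub_stripBridge` — auxiliary file: the Beta strip engine

Helpers for the bridge from the shifted Gauss-multiplication family `GM(n; 1/n, s)` back to the
crux's box side (`n = m + 1`):

* `prod_sub_constMul_mem_newtonLeibnizRel_of_primitive` — ONE Newton–Leibniz move over an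
  arbitrary base `r = [σ, f]` with the kernel coordinate LAST:
  `[σ × [0,1], f ⊗ k] − [σ, (K 1 − K 0)·f] ∈ newtonLeibnizRel` for a kernel `k` with a
  `ℚ`-semialgebraic primitive `K ∈ C([0,1])`, `K' = k` on `(0,1)` (adapted from the crux
  disprover's `prod_iccRep_sub_constMul_mem_newtonLeibnizRel`, BetaCancellation gen 2, §12);
* `equivalent_constMul_of_oneSubPow` — the strip of the value-`1/e` factor: a representation
  `[σ × (0,1), f(x)·(1 − t)^{e−1}]` (`e > 0` rational) is equivalent to `[σ, e⁻¹ f]`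
  (primitive `−(1 − t)^e / e`, null boundary `t ∈ {0, 1}`); `exists_prod_oneSubPow` — such a
  representation exists over every base;
* `exists_betaBox` — the Beta boxes `[(0,1)^m, ∏ⱼ zⱼ^{aⱼ−1}(1 − zⱼ)^{bⱼ−1}]` exist as integral
  representations for positive rational `aⱼ, bⱼ` (semialgebraic by
  `KZ.isSemialgebraicFunOn_mellinIntegrand`, integrable as a product of Beta kernels);
* `finRotate_castSucc'` — the rotation moving coordinate `0` last.

References: Kontsevich–Zagier 2001 §1.2 (rules (1)–(3)); Andrews–Askey–Roy 1999 Thm 1.1.4 (Beta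
integral).
-/
noncomputable section

open MeasureTheory Set
open Literature.NumberTheory.Transcendental
open Literature.NumberTheory.Transcendental.KZ
open Literature.ModelTheory.ExponentialFields (IsSemialgebraic)
open MvPolynomial (aeval X C)
open Literature.NumberTheory.Transcendental.KZreg (unitIoo isSemialgebraic_unitIoo)
open Summit.KontsevichZagierPeriods.KontsevichZagierPeriods.BetaCancellationNegative
  (volume_setOf_apply_eq_zero integrableOn_comp_apply_zero_iff mem_unitIoo)
open Summit.KontsevichZagierPeriods.TerasomaMultiplication.MultiplicationThreeNegative
  (integrableOn_beta)

namespace Summit.KontsevichZagierPeriods.TerasomaMultiplication.MultiplicationAccessible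

variable {n : ℕ}

/-! ## Index bookkeeping -/

/-- The last coordinate of `ℝ^{n+1}` as `Fin.natAdd n 0`. [folklore] -/
theorem natAdd_zero_eq_last' (n : ℕ) : (Fin.natAdd n (0 : Fin 1) : Fin (n + 1)) = Fin.last n :=
  Fin.ext (by simp)

/-- `Fin.init` through `Fin.castAdd 1`. [folklore] -/
theorem init_eq_comp_castAdd' (z : Fin (n + 1) → ℝ) :
    (Fin.init z : Fin n → ℝ) = fun i => z (Fin.castAdd 1 i) := rfl

/-- The rotation `finRotate (n+1)` (`i ↦ i + 1`, last `↦ 0`) on `castSucc j` is `j.succ`.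
[folklore] -/
theorem finRotate_castSucc' (j : Fin n) : finRotate (n + 1) (Fin.castSucc j) = j.succ :=
  Fin.ext (by
    rw [coe_finRotate_of_ne_last (Fin.castSucc_lt_last j).ne, Fin.val_castSucc, Fin.val_succ])

/-! ## The closed unit interval in `ℝ¹` -/

/-- `[0,1] ⊆ ℝ¹` is `ℚ`-semialgebraic. [folklore] -/
theorem isSemialgebraic_unitIcc' : IsSemialgebraic ℚ {x : Fin 1 → ℝ | x 0 ∈ Icc (0:ℝ) 1} := by
  have h1 := Literature.ModelTheory.ExponentialFields.isSemialgebraic_setOf_eval_le (k := ℚ) (R := ℝ)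
    (0 : MvPolynomial (Fin 1) ℚ) (X 0)
  have h2 := Literature.ModelTheory.ExponentialFields.isSemialgebraic_setOf_eval_le (k := ℚ) (R := ℝ)
    (X 0 : MvPolynomial (Fin 1) ℚ) 1
  have h := h1.inter h2
  simp only [map_zero, map_one, MvPolynomial.aeval_X] at h
  have hset : {x : Fin 1 → ℝ | x 0 ∈ Icc (0:ℝ) 1} = {x : Fin 1 → ℝ | 0 ≤ x 0} ∩ {x | x 0 ≤ 1} := by
    ext x
    simp
  rw [hset]
  exact h

/-- `[0,1) ⊆ ℝ¹` is `ℚ`-semialgebraic. [folklore] -/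
theorem isSemialgebraic_unitIco' : IsSemialgebraic ℚ {x : Fin 1 → ℝ | x 0 ∈ Ico (0:ℝ) 1} := by
  have h1 := Literature.ModelTheory.ExponentialFields.isSemialgebraic_setOf_eval_le (k := ℚ) (R := ℝ)
    (0 : MvPolynomial (Fin 1) ℚ) (X 0)
  have h2 := Literature.ModelTheory.ExponentialFields.isSemialgebraic_setOf_eval_pos (k := ℚ) (R := ℝ)
    (1 - X 0 : MvPolynomial (Fin 1) ℚ)
  have h := h1.inter h2
  simp only [map_zero, map_sub, map_one, MvPolynomial.aeval_X, sub_pos] at h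
  have hset : {x : Fin 1 → ℝ | x 0 ∈ Ico (0:ℝ) 1} = {x : Fin 1 → ℝ | 0 ≤ x 0} ∩ {x | x 0 < 1} := by
    ext x
    simp
  rw [hset]
  exact h

/-- `[0,1] ∖ (0,1)` is null in `ℝ¹`. [folklore] -/
theorem volume_unitIcc_diff_unitIoo' :
    volume ({x : Fin 1 → ℝ | x 0 ∈ Icc (0:ℝ) 1} \ unitIoo) = 0 := by
  refine measure_mono_null (fun x hx => ?_)
    (measure_union_null (volume_setOf_apply_eq_zero (0 : Fin 1) 0)
      (volume_setOf_apply_eq_zero (0 : Fin 1) 1))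
  simp only [mem_sdiff, mem_setOf_eq, mem_Icc, mem_unitIoo, mem_Ioo, not_and, not_lt] at hx
  simp only [mem_union, mem_setOf_eq]
  obtain ⟨⟨h1, h2⟩, h3⟩ := hx
  rcases h1.lt_or_eq with h1 | h1
  · exact Or.inr (le_antisymm h2 (h3 h1))
  · exact Or.inl h1.symm

/-! ## One Newton–Leibniz move over an arbitrary base, kernel coordinate last -/

/-- **ONE Newton–Leibniz move over an arbitrary base** (kernel coordinate LAST): if
`κ = [[0,1], k]` and `K ∈ C([0,1])` is a `ℚ`-semialgebraic primitive of `k` on `(0,1)` with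
`K 1 − K 0 = c` algebraic, then `[σ × [0,1], f ⊗ k] − [σ, c·f] ∈ newtonLeibnizRel`, with primitive
`F = f ⊗ K` (semialgebraic on the band by Tarski–Seidenberg, `IntegralRep.leftResolves`).
Adapted from the BetaCancellation disprover's `prod_iccRep_sub_constMul_mem_newtonLeibnizRel`.
[cite: KontsevichZagier2001, §1.2 rule (3)] -/
theorem prod_sub_constMul_mem_newtonLeibnizRel_of_primitive (r : IntegralRep n) (κ : IntegralRep 1)
    {k K : ℝ → ℝ} (hκd : κ.domain = {x | x 0 ∈ Icc (0:ℝ) 1})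
    (hκi : ∀ x ∈ κ.domain, κ.integrand x = k (x 0))
    (hK : IsSemialgebraicFunOn ℚ {x : Fin 1 → ℝ | x 0 ∈ Icc (0:ℝ) 1} (fun x => K (x 0)))
    (hKc : ContinuousOn K (Icc (0:ℝ) 1)) (hKd : ∀ t ∈ Ioo (0:ℝ) 1, HasDerivAt K (k t) t)
    {c : ℝ} (halg : IsAlgebraic ℚ c) (hc : K 1 - K 0 = c) :
    of (r.prod κ) - of (r.constMul c halg) ∈ newtonLeibnizRel := by
  have hF : IsSemialgebraicFunOn ℚ (r.prod κ).domain
      (fun w => r.integrand (Fin.init w) * K (w (Fin.last n))) := by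
    have h := r.leftResolves (hκd ▸ κ.isSemialgebraic_domain) hK
    rw [IntegralRep.prod_domain]
    refine (show IsSemialgebraicFunOn ℚ (IntegralRep.prodDomain r κ) _ from hκd.symm ▸ h).congr
      fun w _ => ?_
    simp only [init_eq_comp_castAdd', natAdd_zero_eq_last']
  have hsnoc : ∀ (x : Fin n → ℝ) (t : ℝ),
      (r.prod κ).integrand (Fin.snoc x t) = r.integrand x * κ.integrand (fun _ => t) := by
    intro x t
    rw [IntegralRep.prod_integrand_eq, IntegralRep.prodFun_apply]
    congr 1
    · congr 1
      funext i
      exact Fin.snoc_castSucc (α := fun _ => ℝ) t x i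
    · congr 1
      funext j
      rw [Fin.fin_one_eq_zero j, natAdd_zero_eq_last', Fin.snoc_last]
  refine ⟨n, r.prod κ, r.constMul c halg, fun _ => ((0:ℕ):ℝ), fun _ => ((0:ℕ):ℝ) + 1,
    fun w => r.integrand (Fin.init w) * K (w (Fin.last n)), hF,
    isSemialgebraicFunOn_natCast r.isSemialgebraic_domain 0, ?_, fun _ _ => by simp, ?_, ?_, ?_,
    ?_, rfl⟩
  · exact (isSemialgebraicFunOn_aeval r.isSemialgebraic_domain
      (((0:ℕ) : MvPolynomial (Fin n) ℚ) + 1)).congr fun x _ => by simp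
  · ext z
    simp only [IntegralRep.prod_domain, IntegralRep.mem_prodDomain, hκd, mem_setOf_eq, mem_Icc,
      IntegralRep.domain_constMul, Nat.cast_zero, zero_add, init_eq_comp_castAdd',
      natAdd_zero_eq_last']
  · intro x _
    simp only [Fin.init_snoc, Fin.snoc_last, Nat.cast_zero, zero_add]
    exact continuousOn_const.mul hKc
  · intro x _ t ht
    simp only [Nat.cast_zero, zero_add] at ht
    have ht' : (fun _ : Fin 1 => t) ∈ κ.domain := by
      rw [hκd]
      exact ⟨ht.1.le, ht.2.le⟩
    simp only [Fin.init_snoc, Fin.snoc_last, hsnoc, hκi _ ht']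
    exact (hKd t ht).const_mul (r.integrand x)
  · intro x _
    simp only [Fin.init_snoc, Fin.snoc_last, IntegralRep.integrand_constMul, Nat.cast_zero,
      zero_add, ← hc]
    ring

/-! ## The kernel `(1 − t)^{e−1}` and its primitive `−(1 − t)^e / e` -/

/-- `[0,1] = [0,1) ∪ {1}` in `ℝ¹`. [folklore] -/
theorem setOf_Icc_eq_Ico_union :
    {x : Fin 1 → ℝ | x 0 ∈ Icc (0:ℝ) 1} = {x | x 0 ∈ Ico (0:ℝ) 1} ∪ {x | x 0 = 1} := by
  ext x
  simp only [mem_setOf_eq, mem_Icc, mem_Ico, mem_union]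
  constructor
  · rintro ⟨h0, h1⟩
    rcases h1.lt_or_eq with h1 | h1
    · exact Or.inl ⟨h0, h1⟩
    · exact Or.inr h1
  · rintro (⟨h0, h1⟩ | h1)
    · exact ⟨h0, h1.le⟩
    · rw [h1]; exact ⟨zero_le_one, le_rfl⟩

/-- `x ↦ κ · (1 − x 0)^e` (`κ, e ∈ ℚ`) is `ℚ`-semialgebraic on `[0,1)` (an Euler–Mellin monomial,
`KZ.isSemialgebraicFunOn_mellinIntegrand`). [folklore] -/
theorem isSemialgebraicFunOn_const_mul_oneSub_rpow_Ico (κ e : ℚ) :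
    IsSemialgebraicFunOn ℚ {x : Fin 1 → ℝ | x 0 ∈ Ico (0:ℝ) 1}
      (fun x => (κ : ℝ) * (1 - x 0) ^ (e : ℝ)) := by
  refine (isSemialgebraicFunOn_mellinIntegrand isSemialgebraic_unitIco' ![1 - X 0] ![e] κ
    (fun x hx i => ?_)).congr fun x _ => ?_
  · have hi : i = 0 := Fin.fin_one_eq_zero i
    subst hi
    have hx' : x 0 < 1 := hx.2
    simpa using hx'
  · simp [mellinIntegrand_apply]

/-- `x ↦ κ · (1 − x 0)^e` extended by the algebraic constant `κ · 0^e` at `x 0 = 1` is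
`ℚ`-semialgebraic on `[0,1]` (gluing, no Tarski–Seidenberg). [folklore] -/
theorem isSemialgebraicFunOn_const_mul_oneSub_rpow_Icc (κ e : ℚ) :
    IsSemialgebraicFunOn ℚ {x : Fin 1 → ℝ | x 0 ∈ Icc (0:ℝ) 1}
      (fun x => (κ : ℝ) * (1 - x 0) ^ (e : ℝ)) := by
  have halg : IsAlgebraic ℚ ((κ : ℝ) * (0:ℝ) ^ (e : ℝ)) := by
    rcases eq_or_ne (e : ℝ) 0 with h | h
    · rw [h, Real.rpow_zero, mul_one]
      exact isAlgebraic_algebraMap κ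
    · rw [Real.zero_rpow h, mul_zero]
      exact isAlgebraic_zero
  -- the point `{x | x 0 = 1}` is semialgebraic (tree: `DilationMoveNegative.isSemialgebraic_pointOne`)
  have hpt : IsSemialgebraic ℚ {x : Fin 1 → ℝ | x 0 = 1} := by
    have h := Literature.ModelTheory.ExponentialFields.isSemialgebraic_setOf_eval_eq_zero (k := ℚ)
      (R := ℝ) (X 0 - 1 : MvPolynomial (Fin 1) ℚ)
    convert h using 1
    ext x
    simp [sub_eq_zero]
  rw [setOf_Icc_eq_Ico_union]
  refine IsSemialgebraicFunOn.union (isSemialgebraicFunOn_const_mul_oneSub_rpow_Ico κ e)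
    (isSemialgebraicFunOn_const_of_isAlgebraic hpt halg) (fun _ _ => rfl) fun x hx => ?_
  have hx' : x 0 = 1 := hx
  simp only [hx', sub_self]

/-- The kernel `(1 − t)^{e−1}` is integrable on `[0,1]` for rational `e > 0` (a Beta kernel).
[folklore] -/
theorem integrableOn_oneSub_rpow {e : ℚ} (he : 0 < e) :
    IntegrableOn (fun t : ℝ => (1 - t) ^ ((e:ℝ) - 1)) (Icc (0:ℝ) 1) := by
  have he' : (0:ℝ) < e := by exact_mod_cast he
  rw [integrableOn_Icc_iff_integrableOn_Ioo]
  exact (integrableOn_beta one_pos he').congr_fun (fun t _ => by simp) measurableSet_Ioo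

/-- The primitive `−(1 − t)^e / e` is continuous on `[0,1]` for rational `e > 0`. [folklore] -/
theorem continuousOn_oneSub_rpow_prim {e : ℚ} (he : 0 < e) :
    ContinuousOn (fun t : ℝ => -(1 - t) ^ (e:ℝ) / e) (Icc (0:ℝ) 1) := by
  have he' : (0:ℝ) ≤ e := by exact_mod_cast he.le
  exact (((continuousOn_const.sub continuousOn_id).rpow_const fun t _ => Or.inr he').neg).div_const _

/-- `d/dt (−(1 − t)^e / e) = (1 − t)^{e−1}` on `(0,1)`. [folklore] -/
theorem hasDerivAt_oneSub_rpow_prim {e : ℚ} (he : 0 < e) {t : ℝ} (ht : t ∈ Ioo (0:ℝ) 1) :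
    HasDerivAt (fun t : ℝ => -(1 - t) ^ (e:ℝ) / e) ((1 - t) ^ ((e:ℝ) - 1)) t := by
  have he0 : (e:ℝ) ≠ 0 := by exact_mod_cast he.ne'
  have h1 : HasDerivAt (fun s : ℝ => 1 - s) (-1) t := by
    simpa using (hasDerivAt_id t).const_sub (1:ℝ)
  have h2 := ((h1.rpow_const (p := (e:ℝ)) (Or.inl (sub_ne_zero.2 ht.2.ne'))).neg).div_const (e:ℝ)
  refine h2.congr_deriv ?_
  field_simp

/-- `K 1 − K 0 = e⁻¹` for the primitive `K = −(1 − t)^e / e`. [folklore] -/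
theorem oneSub_rpow_prim_one_sub_zero {e : ℚ} (he : 0 < e) :
    (fun t : ℝ => -(1 - t) ^ (e:ℝ) / e) 1 - (fun t : ℝ => -(1 - t) ^ (e:ℝ) / e) 0 = (e:ℝ)⁻¹ := by
  have he0 : (e:ℝ) ≠ 0 := by exact_mod_cast he.ne'
  simp only [sub_self, Real.zero_rpow he0, neg_zero, zero_div, sub_zero, Real.one_rpow, zero_sub]
  rw [neg_div, neg_neg, one_div]

/-! ## Stripping the value-`1/e` factor -/

/-- **Strip of a Beta factor of value `1/e`.** If `q = [σ × (0,1), f(x)·(1 − t)^{e−1}]` (kernel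
coordinate last, `e > 0` rational) over a base `r = [σ, f]`, and `c = e⁻¹` (algebraic), then
`q ∼ [σ, c·f]`: congruence onto `r × [(0,1), k]`, the null boundary `t ∈ {0,1}`
(`IntegralRep.of_sub_of_restrict_mem_relations`), and ONE Newton–Leibniz move with primitive
`f(x)·(−(1 − t)^e / e)` (`prod_sub_constMul_mem_newtonLeibnizRel_of_primitive`).
[cite: KontsevichZagier2001, §1.2 rule (3)] -/
theorem equivalent_constMul_of_oneSubPow (r : IntegralRep n) {e : ℚ} (he : 0 < e)
    (q : IntegralRep (n + 1))
    (hqd : q.domain =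
      {z : Fin (n + 1) → ℝ | (Fin.init z : Fin n → ℝ) ∈ r.domain ∧ z (Fin.last n) ∈ Ioo (0:ℝ) 1})
    (hqi : EqOn q.integrand
      (fun z => r.integrand (Fin.init z) * (1 - z (Fin.last n)) ^ ((e:ℝ) - 1)) q.domain)
    {c : ℝ} (halg : IsAlgebraic ℚ c) (hc : (e:ℝ)⁻¹ = c) :
    Equivalent q (r.constMul c halg) := by
  have hk_sa : IsSemialgebraicFunOn ℚ {x : Fin 1 → ℝ | x 0 ∈ Icc (0:ℝ) 1}
      (fun x => (1 - x 0) ^ ((e:ℝ) - 1)) := by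
    refine (isSemialgebraicFunOn_const_mul_oneSub_rpow_Icc 1 (e - 1)).congr fun x _ => ?_
    simp
  have hK_sa : IsSemialgebraicFunOn ℚ {x : Fin 1 → ℝ | x 0 ∈ Icc (0:ℝ) 1}
      (fun x => (fun t : ℝ => -(1 - t) ^ (e:ℝ) / e) (x 0)) := by
    refine (isSemialgebraicFunOn_const_mul_oneSub_rpow_Icc (-e⁻¹) e).congr fun x _ => ?_
    simp only [Rat.cast_neg, Rat.cast_inv]
    ring
  obtain ⟨κ, hκd, hκi⟩ : ∃ κ : IntegralRep 1, κ.domain = {x | x 0 ∈ Icc (0:ℝ) 1} ∧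
      κ.integrand = fun x => (1 - x 0) ^ ((e:ℝ) - 1) :=
    ⟨⟨_, _, isSemialgebraic_unitIcc', hk_sa,
      integrableOn_comp_apply_zero_iff.2 (integrableOn_oneSub_rpow he)⟩, rfl, rfl⟩
  have hsub : unitIoo ⊆ κ.domain := by
    rw [hκd]
    exact fun x hx => ⟨hx.1.le, hx.2.le⟩
  set κ₀ := κ.restrict unitIoo isSemialgebraic_unitIoo hsub with hκ₀
  have h1 : Equivalent q (r.prod κ₀) := by
    refine of_sub_of_mem_relations_of_eqOn ?_ fun z hz => ?_
    · ext z
      simp only [IntegralRep.prod_domain, IntegralRep.mem_prodDomain, hκ₀,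
        IntegralRep.domain_restrict, mem_unitIoo, hqd, mem_setOf_eq, init_eq_comp_castAdd',
        natAdd_zero_eq_last']
    · rw [hqi hz, IntegralRep.prod_integrand_eq, IntegralRep.prodFun_apply, hκ₀,
        IntegralRep.integrand_restrict, hκi]
      simp only [init_eq_comp_castAdd', natAdd_zero_eq_last']
  have h2 : Equivalent (r.prod κ₀) (r.prod κ) :=
    Equivalent.prod (Equivalent.refl r) (Equivalent.symm
      (κ.of_sub_of_restrict_mem_relations isSemialgebraic_unitIoo hsub
        (by rw [hκd]; exact volume_unitIcc_diff_unitIoo')))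
  have h3 : Equivalent (r.prod κ) (r.constMul c halg) :=
    newtonLeibnizRel_subset_relations
      (prod_sub_constMul_mem_newtonLeibnizRel_of_primitive r κ hκd
        (fun x _ => by rw [hκi]) hK_sa (continuousOn_oneSub_rpow_prim he)
        (fun t ht => hasDerivAt_oneSub_rpow_prim he ht) halg
        ((oneSub_rpow_prim_one_sub_zero he).trans hc))
  exact (h1.trans h2).trans h3

/-- **Existence of the strip**: over every base `r = [σ, f]` the representation
`[σ × (0,1), f(x)·(1 − t)^{e−1}]` exists (`r ⊗ [(0,1), (1 − t)^{e−1}]`) and is equivalent to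
`[σ, e⁻¹ f]`. [cite: KontsevichZagier2001, §1.2 rule (3)] -/
theorem exists_prod_oneSubPow (r : IntegralRep n) {e : ℚ} (he : 0 < e) {c : ℝ}
    (halg : IsAlgebraic ℚ c) (hc : (e:ℝ)⁻¹ = c) :
    ∃ R : IntegralRep (n + 1),
      R.domain = {z : Fin (n + 1) → ℝ |
        (Fin.init z : Fin n → ℝ) ∈ r.domain ∧ z (Fin.last n) ∈ Ioo (0:ℝ) 1} ∧
      (R.integrand = fun z => r.integrand (Fin.init z) * (1 - z (Fin.last n)) ^ ((e:ℝ) - 1)) ∧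
      Equivalent R (r.constMul c halg) := by
  have hk : IsSemialgebraicFunOn ℚ unitIoo (fun x : Fin 1 → ℝ => (1 - x 0) ^ ((e:ℝ) - 1)) := by
    refine ((isSemialgebraicFunOn_const_mul_oneSub_rpow_Icc 1 (e - 1)).mono
      (fun x hx => ⟨hx.1.le, hx.2.le⟩) isSemialgebraic_unitIoo).congr fun x _ => ?_
    simp
  have hi : IntegrableOn (fun x : Fin 1 → ℝ => (1 - x 0) ^ ((e:ℝ) - 1)) unitIoo :=
    integrableOn_comp_apply_zero_iff.2
      ((integrableOn_oneSub_rpow he).mono_set Ioo_subset_Icc_self)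
  obtain ⟨κ, hκd, hκi⟩ : ∃ κ : IntegralRep 1, κ.domain = unitIoo ∧
      κ.integrand = fun x => (1 - x 0) ^ ((e:ℝ) - 1) :=
    ⟨⟨_, _, isSemialgebraic_unitIoo, hk, hi⟩, rfl, rfl⟩
  have hd : (r.prod κ).domain = {z : Fin (n + 1) → ℝ |
      (Fin.init z : Fin n → ℝ) ∈ r.domain ∧ z (Fin.last n) ∈ Ioo (0:ℝ) 1} := by
    ext z
    simp only [IntegralRep.prod_domain, IntegralRep.mem_prodDomain, hκd, mem_unitIoo,
      mem_setOf_eq, init_eq_comp_castAdd', natAdd_zero_eq_last']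
  have hi' : (r.prod κ).integrand =
      fun z => r.integrand (Fin.init z) * (1 - z (Fin.last n)) ^ ((e:ℝ) - 1) := by
    funext z
    rw [IntegralRep.prod_integrand_eq, IntegralRep.prodFun_apply, hκi]
    simp only [init_eq_comp_castAdd', natAdd_zero_eq_last']
  exact ⟨r.prod κ, hd, hi',
    equivalent_constMul_of_oneSubPow r he (r.prod κ) hd (fun z _ => by rw [hi']) halg hc⟩

/-! ## Beta boxes -/

variable {m : ℕ}

/-- The Beta-box integrand `∏ⱼ zⱼ^{aⱼ}(1 − zⱼ)^{bⱼ}` (`aⱼ, bⱼ ∈ ℚ`) is `ℚ`-semialgebraic on the open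
box: it is the Euler–Mellin integrand of the family `(Xⱼ)ⱼ ++ (1 − Xⱼ)ⱼ`. [folklore] -/
theorem isSemialgebraicFunOn_betaBoxFun (a b : Fin m → ℚ) :
    IsSemialgebraicFunOn ℚ {x : Fin m → ℝ | ∀ j, x j ∈ Ioo (0:ℝ) 1}
      (fun x => ∏ j, (x j) ^ ((a j : ℚ) : ℝ) * (1 - x j) ^ ((b j : ℚ) : ℝ)) := by
  refine (isSemialgebraicFunOn_mellinIntegrand (isSemialgebraic_box m)
    (Fin.append (fun j => (X j : MvPolynomial (Fin m) ℚ)) (fun j => 1 - X j))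
    (Fin.append a b) 1 ?_).congr ?_
  · intro x hx k
    induction k using Fin.addCases with
    | left i => simp only [Fin.append_left, MvPolynomial.aeval_X]; exact (hx i).1
    | right j =>
      simp only [Fin.append_right, map_sub, map_one, MvPolynomial.aeval_X, sub_pos]
      exact (hx j).2
  · intro x _
    simp only [mellinIntegrand_apply, Fin.prod_univ_add, Fin.append_left, Fin.append_right,
      map_sub, map_one, MvPolynomial.aeval_X, Rat.cast_one, one_mul]
    rw [← Finset.prod_mul_distrib]

/-- The Beta-box integrand `∏ⱼ zⱼ^{aⱼ−1}(1 − zⱼ)^{bⱼ−1}` is absolutely integrable on the open box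
for `aⱼ, bⱼ > 0` (product of Beta kernels, `Integrable.fin_nat_prod`).
[folklore] -/
theorem integrableOn_betaBoxFun {a b : Fin m → ℝ} (ha : ∀ j, 0 < a j) (hb : ∀ j, 0 < b j) :
    IntegrableOn (fun x : Fin m → ℝ => ∏ j, (x j) ^ (a j - 1) * (1 - x j) ^ (b j - 1))
      {x | ∀ j, x j ∈ Ioo (0:ℝ) 1} := by
  have hbox : {x : Fin m → ℝ | ∀ j, x j ∈ Ioo (0:ℝ) 1} = Set.pi univ fun _ => Ioo (0:ℝ) 1 := by
    ext x
    simp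
  rw [IntegrableOn, hbox, volume_pi, Measure.restrict_pi_pi]
  exact Integrable.fin_nat_prod (f := fun j (t : ℝ) => t ^ (a j - 1) * (1 - t) ^ (b j - 1))
    fun j => integrableOn_beta (ha j) (hb j)

/-- **The Beta boxes exist**: `[(0,1)^m, ∏ⱼ zⱼ^{aⱼ−1}(1 − zⱼ)^{bⱼ−1}]` is an integral
representation for positive rational `aⱼ, bⱼ`. [folklore] -/
theorem exists_betaBox (a b : Fin m → ℚ) (ha : ∀ j, 0 < a j) (hb : ∀ j, 0 < b j) :
    ∃ d : IntegralRep m, d.domain = {x | ∀ j, x j ∈ Ioo (0:ℝ) 1} ∧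
      d.integrand = fun x => ∏ j, (x j) ^ ((a j : ℝ) - 1) * (1 - x j) ^ ((b j : ℝ) - 1) := by
  have ha' : ∀ j, (0:ℝ) < a j := fun j => by exact_mod_cast ha j
  have hb' : ∀ j, (0:ℝ) < b j := fun j => by exact_mod_cast hb j
  refine ⟨⟨_, _, isSemialgebraic_box m, ?_, integrableOn_betaBoxFun ha' hb'⟩, rfl, rfl⟩
  refine (isSemialgebraicFunOn_betaBoxFun (fun j => a j - 1) (fun j => b j - 1)).congr
    fun x _ => ?_
  simp only [Rat.cast_sub, Rat.cast_one]

/-! ## Registered sub-goal -/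

/-- **Registered sub-goal `stub_stripBridge_strip` of stub `stub_stripBridge`** (the strip engine,
`∀`-form of `exists_prod_oneSubPow`): over every base `r = [σ, f]` the representation
`r ⊗ [(0,1), (1 − t)^{e−1}]` exists and is equivalent to `[σ, e⁻¹ f]`.
[cite: KontsevichZagier2001, §1.2 rule (3)] -/
theorem stub_stripBridge_strip :
    ∀ (n : ℕ) (r : KZ.IntegralRep n) (e : ℚ), 0 < e → ∀ (c : ℝ) (hc : IsAlgebraic ℚ c),
      (e:ℝ)⁻¹ = c → ∃ R : KZ.IntegralRep (n + 1),
        R.domain = {z : Fin (n + 1) → ℝ |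
          (Fin.init z : Fin n → ℝ) ∈ r.domain ∧ z (Fin.last n) ∈ Set.Ioo (0:ℝ) 1} ∧
        (R.integrand = fun z => r.integrand (Fin.init z) * (1 - z (Fin.last n)) ^ ((e:ℝ) - 1)) ∧
        KZ.Equivalent R (r.constMul c hc) :=
  fun _ r _ he _ halg hc => exists_prod_oneSubPow r he halg hc

end Summit.KontsevichZagierPeriods.TerasomaMultiplication.MultiplicationAccessible
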